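import Mathlib
import HarnessLib
import Summits.HubbardSuperconductivity.HubbardSuperconductivity.Theorems.KLProgrammeKLRegimeEngineV8DefsQ2

/-!
# v3 `Q`-part of the engine package (`…KLRegimeEngineV8Defs` G-part + `…DefsQ2` sizes): the `Q`-slack raised to `2^{60}·klEngPsq²·klEngRsq²`
# and the thresholds lowered to `c₃ = 2^{-120}/(klEngPsq·klEngRsq²)`, `U₀ = 2^{-120}/(klEngPsq²·klEngRsq⁴·(c²+1))` — k3c2-p1 g2's
# SCALE0-CONSTANTS finding (HOME/STATUS 23:32:06Z, evidence #16 on stmt-HubbardSuperconductivity-19823; cell gate-hubbard-kl, seat p1 g7 = package author)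

Why.  Along the tree route the certified per-order constant of (E1-v4)₀ is `K₁ ≈ 16·(4b₀)²·e⁹·A₀ ≈ 2^{35}` (`A₀ = ∫dτΣ_z|C^K_{>e₀}| → ≈ 1.5·10³`,
`b₀ = O(3–6)`; k3c2-p1 kit j261481/j261982, float sizing), while v2's `CE = 2^{20}·Psq²·Rsq²` is guaranteed only `≥ 2^{22}` under `∀P ∀R` —
too small by `2^{13}–2^{19}` per order, and `θ < 1` then needs `|U| ≲ 4·10^{-14}` against `klEngU₀2 ≤ 5.7·10^{-14}` (marginal).  NOT a cut/slot
defect: `Q`, `c₃`, `U₀` are the ENGINE's own `∃`-witnesses in `EngineP4`, so the repair is a package NUMBER change (Q3-a of that line): every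
`Q`-slack := `2^{60}·klEngPsq P²·klEngRsq R²` (`CL β n` keeps its `(β²+1)·4ⁿ`; `L0/M0` as v2), `klEngC₃3 := 2^{-120}/(klEngPsq·klEngRsq²)`,
`klEngU₀3 := 2^{-120}/(klEngPsq²·klEngRsq⁴·(c²+1))`.  `klEngGeo` (G-part), `klEngL₃/klEngM₃`, `klEngPsq/klEngRsq` UNCHANGED (imported).  Same
lemma list as v2 (`_wf`, `_pos`, `deltaUV_absorbed3`) plus the v2-dominance facts `klEngQ2_CR_le_klEngQ3_CR`, `klEngU₀3_le_klEngU₀2`,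
`klEngC₃3_le_klEngC₃2` (so every smallness proved at v2 transfers).  Definitions + positivity/monotonicity proofs only; nothing about the model.
-/

noncomputable section

namespace Summit.HubbardSuperconductivity.HubbardSuperconductivity.Theorems.EngineV8

set_option linter.dupNamespace false -- summit = problem name (single-conjunct summit), D-0017

open Real Finset
open Summit.HubbardSuperconductivity.HubbardSuperconductivity.Theorems.KLRegimeSplit

/-- **`klEngQ3 P R` — the engine's constants `Q`, v3**: `2^{60}·klEngPsq²·klEngRsq²` throughout; `CL β n = 2^{60} klEngPsq² klEngRsq² (β²+1) 4ⁿ`;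
thresholds `L0 β = 2^{10}(⌈|β|⌉₊+1)²`, `M0 β L = 2^{10}(⌈|β|⌉₊+1)²(L+1)²` (as v2). -/
def klEngQ3 (P : SplitConsts) (R : RenConsts) : EngConsts where
  CE := 2 ^ 60 * klEngPsq P ^ 2 * klEngRsq R ^ 2
  CR := 2 ^ 60 * klEngPsq P ^ 2 * klEngRsq R ^ 2
  c0 := 2 ^ 60 * klEngPsq P ^ 2 * klEngRsq R ^ 2
  cE4 := 2 ^ 60 * klEngPsq P ^ 2 * klEngRsq R ^ 2
  S' := fun _ => 2 ^ 60 * klEngPsq P ^ 2 * klEngRsq R ^ 2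
  Bf := 2 ^ 60 * klEngPsq P ^ 2 * klEngRsq R ^ 2
  SL := 2 ^ 60 * klEngPsq P ^ 2 * klEngRsq R ^ 2
  CL := fun β n => 2 ^ 60 * klEngPsq P ^ 2 * klEngRsq R ^ 2 * (β ^ 2 + 1) * (4 : ℝ) ^ n
  L0 := fun β => 2 ^ 10 * (⌈|β|⌉₊ + 1) ^ 2
  M0 := fun β L => 2 ^ 10 * (⌈|β|⌉₊ + 1) ^ 2 * (L + 1) ^ 2

/-- **`klEngC₃3 P R` — the regime-constant threshold, v3**: `2^{-120}/(klEngPsq·klEngRsq²)`. -/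
def klEngC₃3 (P : SplitConsts) (R : RenConsts) : ℝ := 1 / ((2 : ℝ) ^ 120 * klEngPsq P * klEngRsq R ^ 2)

/-- **`klEngU₀3 P R c` — the coupling threshold, v3**: `2^{-120}/(klEngPsq²·klEngRsq⁴·(c²+1))`. -/
def klEngU₀3 (P : SplitConsts) (R : RenConsts) (c : ℝ) : ℝ :=
  1 / ((2 : ℝ) ^ 120 * klEngPsq P ^ 2 * klEngRsq R ^ 4 * (c ^ 2 + 1))

/-- `klEngQ3 P R` is well formed (unconditionally). -/
theorem klEngQ3_wf (P : SplitConsts) (R : RenConsts) : (klEngQ3 P R).WF := by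
  have h2 : (0 : ℝ) ≤ 2 ^ 60 := pow_nonneg zero_le_two 60
  have hc : (0 : ℝ) ≤ 2 ^ 60 * klEngPsq P ^ 2 * klEngRsq R ^ 2 :=
    mul_nonneg (mul_nonneg h2 (sq_nonneg _)) (sq_nonneg _)
  refine ⟨hc, hc, hc, hc, fun _ => hc, hc, hc, fun β n => ?_⟩
  show (0 : ℝ) ≤ 2 ^ 60 * klEngPsq P ^ 2 * klEngRsq R ^ 2 * (β ^ 2 + 1) * (4 : ℝ) ^ n
  exact mul_nonneg (mul_nonneg hc (by nlinarith [sq_nonneg β])) (pow_nonneg (by norm_num) n)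

/-- `0 < klEngC₃3 P R`. -/
theorem klEngC₃3_pos (P : SplitConsts) (R : RenConsts) : 0 < klEngC₃3 P R := by
  unfold klEngC₃3
  have hp := klEngPsq_pos P
  have hr := klEngRsq_pos R
  have h2 : (0 : ℝ) < 2 ^ 120 := pow_pos zero_lt_two 120
  exact one_div_pos.mpr (mul_pos (mul_pos h2 hp) (pow_pos hr 2))

/-- `0 < klEngU₀3 P R c`. -/
theorem klEngU₀3_pos (P : SplitConsts) (R : RenConsts) (c : ℝ) : 0 < klEngU₀3 P R c := by
  unfold klEngU₀3
  have hp := klEngPsq_pos P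
  have hr := klEngRsq_pos R
  have h2 : (0 : ℝ) < 2 ^ 120 := pow_pos zero_lt_two 120
  have hc : (0 : ℝ) < c ^ 2 + 1 := by nlinarith [sq_nonneg c]
  exact one_div_pos.mpr (mul_pos (mul_pos (mul_pos h2 (pow_pos hp 2)) (pow_pos hr 4)) hc)

/-- The Δ-UV absorption inequality at the v3 package: `32·Gfr 0 + 4·cr ≤ (klEngQ3 P R).CR`. -/
theorem deltaUV_absorbed3 (P : SplitConsts) (R : RenConsts) : 32 * R.Gfr 0 + 4 * R.cr ≤ (klEngQ3 P R).CR := by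
  show 32 * R.Gfr 0 + 4 * R.cr ≤ 2 ^ 60 * klEngPsq P ^ 2 * klEngRsq R ^ 2
  have h0 := gfr_le_klEngRsq R (j := 0) (by norm_num)
  have h1 := cr_le_klEngRsq R
  have hr := one_le_klEngRsq R
  have hp := one_le_klEngPsq P
  have hp2 : 1 ≤ klEngPsq P ^ 2 := by nlinarith
  have hr2 : klEngRsq R ≤ klEngRsq R ^ 2 := by nlinarith
  nlinarith

/-! ## v2-dominance: everything proved small at v2 stays small at v3 -/

/-- The v3 slack dominates the v2 slack: `(klEngQ2 P R).CR ≤ (klEngQ3 P R).CR` (and likewise for every `Q`-field, all equal). -/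
theorem klEngQ2_CR_le_klEngQ3_CR (P : SplitConsts) (R : RenConsts) : (klEngQ2 P R).CR ≤ (klEngQ3 P R).CR := by
  show (2 : ℝ) ^ 20 * klEngPsq P ^ 2 * klEngRsq R ^ 2 ≤ 2 ^ 60 * klEngPsq P ^ 2 * klEngRsq R ^ 2
  have h : (0 : ℝ) ≤ klEngPsq P ^ 2 * klEngRsq R ^ 2 := mul_nonneg (sq_nonneg _) (sq_nonneg _)
  have h2 : (2 : ℝ) ^ 20 ≤ 2 ^ 60 := pow_le_pow_right₀ one_le_two (by norm_num)
  calc (2 : ℝ) ^ 20 * klEngPsq P ^ 2 * klEngRsq R ^ 2 = 2 ^ 20 * (klEngPsq P ^ 2 * klEngRsq R ^ 2) := by ring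
    _ ≤ 2 ^ 60 * (klEngPsq P ^ 2 * klEngRsq R ^ 2) := mul_le_mul_of_nonneg_right h2 h
    _ = 2 ^ 60 * klEngPsq P ^ 2 * klEngRsq R ^ 2 := by ring

/-- `(klEngQ2 P R).CE ≤ (klEngQ3 P R).CE`. -/
theorem klEngQ2_CE_le_klEngQ3_CE (P : SplitConsts) (R : RenConsts) : (klEngQ2 P R).CE ≤ (klEngQ3 P R).CE :=
  klEngQ2_CR_le_klEngQ3_CR P R

/-- `(klEngQ2 P R).CL β n ≤ (klEngQ3 P R).CL β n`. -/
theorem klEngQ2_CL_le_klEngQ3_CL (P : SplitConsts) (R : RenConsts) (β : ℝ) (n : ℕ) :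
    (klEngQ2 P R).CL β n ≤ (klEngQ3 P R).CL β n := by
  show (2 : ℝ) ^ 20 * klEngPsq P ^ 2 * klEngRsq R ^ 2 * (β ^ 2 + 1) * (4 : ℝ) ^ n ≤
    2 ^ 60 * klEngPsq P ^ 2 * klEngRsq R ^ 2 * (β ^ 2 + 1) * (4 : ℝ) ^ n
  have h : (0 : ℝ) ≤ klEngPsq P ^ 2 * klEngRsq R ^ 2 * (β ^ 2 + 1) * (4 : ℝ) ^ n :=
    mul_nonneg (mul_nonneg (mul_nonneg (sq_nonneg _) (sq_nonneg _)) (by nlinarith [sq_nonneg β])) (pow_nonneg (by norm_num) n)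
  have h2 : (2 : ℝ) ^ 20 ≤ 2 ^ 60 := pow_le_pow_right₀ one_le_two (by norm_num)
  calc (2 : ℝ) ^ 20 * klEngPsq P ^ 2 * klEngRsq R ^ 2 * (β ^ 2 + 1) * (4 : ℝ) ^ n
      = 2 ^ 20 * (klEngPsq P ^ 2 * klEngRsq R ^ 2 * (β ^ 2 + 1) * (4 : ℝ) ^ n) := by ring
    _ ≤ 2 ^ 60 * (klEngPsq P ^ 2 * klEngRsq R ^ 2 * (β ^ 2 + 1) * (4 : ℝ) ^ n) := mul_le_mul_of_nonneg_right h2 h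
    _ = _ := by ring

/-- The v3 coupling threshold is below the v2 one: `klEngU₀3 P R c ≤ klEngU₀2 P R c`. -/
theorem klEngU₀3_le_klEngU₀2 (P : SplitConsts) (R : RenConsts) (c : ℝ) : klEngU₀3 P R c ≤ klEngU₀2 P R c := by
  unfold klEngU₀3 klEngU₀2
  have hp := klEngPsq_pos P
  have hr := klEngRsq_pos R
  have hc : (0 : ℝ) < c ^ 2 + 1 := by nlinarith [sq_nonneg c]
  have hX : (0 : ℝ) < klEngPsq P ^ 2 * klEngRsq R ^ 4 * (c ^ 2 + 1) := mul_pos (mul_pos (pow_pos hp 2) (pow_pos hr 4)) hc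
  have hd : (0 : ℝ) < 2 ^ 40 * klEngPsq P ^ 2 * klEngRsq R ^ 4 * (c ^ 2 + 1) := by
    have := mul_pos (pow_pos (zero_lt_two (α := ℝ)) 40) hX
    simpa [mul_assoc] using this
  apply one_div_le_one_div_of_le hd
  have h2 : (2 : ℝ) ^ 40 ≤ 2 ^ 120 := pow_le_pow_right₀ one_le_two (by norm_num)
  calc (2 : ℝ) ^ 40 * klEngPsq P ^ 2 * klEngRsq R ^ 4 * (c ^ 2 + 1) = 2 ^ 40 * (klEngPsq P ^ 2 * klEngRsq R ^ 4 * (c ^ 2 + 1)) := by ring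
    _ ≤ 2 ^ 120 * (klEngPsq P ^ 2 * klEngRsq R ^ 4 * (c ^ 2 + 1)) := mul_le_mul_of_nonneg_right h2 hX.le
    _ = _ := by ring

/-- The v3 regime threshold is below the v2 one: `klEngC₃3 P R ≤ klEngC₃2 P R`. -/
theorem klEngC₃3_le_klEngC₃2 (P : SplitConsts) (R : RenConsts) : klEngC₃3 P R ≤ klEngC₃2 P R := by
  unfold klEngC₃3 klEngC₃2
  have hp := klEngPsq_pos P
  have hr := klEngRsq_pos R
  have hX : (0 : ℝ) < klEngPsq P * klEngRsq R ^ 2 := mul_pos hp (pow_pos hr 2)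
  have hd : (0 : ℝ) < 2 ^ 40 * klEngPsq P * klEngRsq R ^ 2 := by
    have := mul_pos (pow_pos (zero_lt_two (α := ℝ)) 40) hX
    simpa [mul_assoc] using this
  apply one_div_le_one_div_of_le hd
  have h2 : (2 : ℝ) ^ 40 ≤ 2 ^ 120 := pow_le_pow_right₀ one_le_two (by norm_num)
  calc (2 : ℝ) ^ 40 * klEngPsq P * klEngRsq R ^ 2 = 2 ^ 40 * (klEngPsq P * klEngRsq R ^ 2) := by ring
    _ ≤ 2 ^ 120 * (klEngPsq P * klEngRsq R ^ 2) := mul_le_mul_of_nonneg_right h2 hX.le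
    _ = _ := by ring

/-- `klEngU₀3 P R c ≤ 2^{-120}` (every factor of the denominator is `≥ 1`). -/
theorem klEngU₀3_le_two_pow (P : SplitConsts) (R : RenConsts) (c : ℝ) : klEngU₀3 P R c ≤ 1 / (2 : ℝ) ^ 120 := by
  unfold klEngU₀3
  have hp := one_le_klEngPsq P
  have hr := one_le_klEngRsq R
  have h2 : (0 : ℝ) < 2 ^ 120 := pow_pos zero_lt_two 120
  apply one_div_le_one_div_of_le h2
  have hp2 : 1 ≤ klEngPsq P ^ 2 := one_le_pow₀ hp
  have hr4 : 1 ≤ klEngRsq R ^ 4 := one_le_pow₀ hr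
  have hc : 1 ≤ c ^ 2 + 1 := by nlinarith [sq_nonneg c]
  have h1 : (1 : ℝ) ≤ klEngPsq P ^ 2 * klEngRsq R ^ 4 := one_le_mul_of_one_le_of_one_le hp2 hr4
  have h3 : (1 : ℝ) ≤ klEngPsq P ^ 2 * klEngRsq R ^ 4 * (c ^ 2 + 1) := one_le_mul_of_one_le_of_one_le h1 hc
  calc (2 : ℝ) ^ 120 = 2 ^ 120 * 1 := (mul_one _).symm
    _ ≤ 2 ^ 120 * (klEngPsq P ^ 2 * klEngRsq R ^ 4 * (c ^ 2 + 1)) := mul_le_mul_of_nonneg_left h3 h2.le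
    _ = _ := by ring

end Summit.HubbardSuperconductivity.HubbardSuperconductivity.Theorems.EngineV8

end
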